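import Summits.CriticalPhenomena.PercolationContinuityZ3.Theorems.PercNearOneGluingNoHeavyQuantAD3FourAtom
import HarnessLib

/-!
# QUANT lane R8, T-DEC, ROUTE 2: EVERY ADMISSIBLE FOUR-ATOM LAW WITH A ZERO ATOM IS AD3⁺ (regime assembly)

builds on p205010 (kernel theorem, internal audit signed; external expert review pending)

Support file (`--supports stmt-CriticalPhenomena-4575`), QUANT lane, seat prim-quant-arm-2 (gen 37), rung R8 of
`run/shared/lean/prim/quant/LADDER.md`; assembles `…QuantAD3FourAtomFlows` (sufficiency), `…QuantAD3FourAtomDual` (necessity) and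
`…QuantAD3FourAtom` (the level-line theorem).  Memo `run/shared/lean/prim/quant/prim-quant-arm-2-g37/AD3-GATE4-G37.md`.
Theorems only, standard axioms, no sorries.

**THEOREM (`LawDec.ad3Decomp_fourAtom`).**  Let `0 < a < b < c ≤ M`, `0 < y < q ≤ 1`, and `ν = (w₀, w_a, w_b, w_c) ≥ 0` a law on
`{0, a, b, c}` of mean `T` with `y·M ≤ q·T` (top-affordable) whose `q`-gate is DEC at every layer `j′ < M` (floor `y`).  Then `ν`
admits an AD3⁺ decomposition at `(y, q, T, M)` (`LawDec.AD3Decomp`).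
PROOF.  `τ := qT`, `(Z, A, B, C) := (1 − q + qw₀, qw_a, qw_b, qw_c)` the gated masses.  By regime: `τ ≤ 2a` — every mean-`T` law
on the atoms is admissible (`fourAtom_decAt_of_bigLow`); `2a < τ`, `2b < τ` — admissible ⟺ `y ≤ C` (slope `θ = 0`); `2a < τ`,
`a + b ≤ τ ≤ 2b` — admissible ⟺ `y ≤ yB + C` (`θ = y`); `2a < τ < a + b` — admissible ⟺ `y ≤ B + C ∧ y ≤ y(1 + 1/r)B + C`,
`r = usage(a,b)`, i.e. `y ≤ min(1, y(1+1/r))·B + C` (`θ = min(1, y(1 + 1/r))`).  In each case the admissible set is the mean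
polygon cut by the half-plane `θ·B + C ≥ const`, the level line of `ν` lies in it, and `ad3Decomp_fourAtom_of_levelLine` concludes.
CONTRAST: arm-2 g35's admissible non-AD3⁺ vertex `{1: 4/27, 2: 1/54, 4: 5/54, 6: 20/27}` (`q = 9/10`, `y = 3/4`) is zero-FREE —
two admissibility constraints cross inside its mean polygon; with a zero atom this never happens.
EXACT EVIDENCE (arm-2 g37): cell census 62 500 / 0; admissible polygons ≈ 5 000 / 0 interior vertices; the characterisation
156 190 / 156 190; the explicit two-piece rule 4 808 / 4 808 hard instances without any LP.

* **`LawDec.ad3Decomp_fourAtom`** — the theorem.  (The cell `AD3GateTriple4` = the case `ν = gate_{q₀}{s₁,s₂,s₃}`, `T = q₀·mean`,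
  follows in `…QuantAD3GateTriple4Holds` once typer g31's `…QuantAD3GateCellReduction` is in the tree.)

[this work] (this lane).  The gluing rows served [cite: KozmaNitzan2024, Conjecture 3 (p. 15)]; product measure [cite: Grimmett1999, §1.3 p. 10].
-/

noncomputable section

namespace Summit.CriticalPhenomena.PercolationContinuityZ3.Theorems

namespace Quant

open Finset

/-- four-atom law notation `QD[a, b, c, Z, A, B, C, h] = Z·[h = 0] + A·[h = a] + B·[h = b] + C·[h = c]`. -/
local notation3 "QD[" a ", " b ", " c ", " Z ", " A ", " B ", " C ", " h "]" =>
  (Z : ℝ) * (if (h : ℕ) = (0 : ℕ) then (1 : ℝ) else 0) + (A : ℝ) * (if (h : ℕ) = (a : ℕ) then (1 : ℝ) else 0)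
    + (B : ℝ) * (if (h : ℕ) = (b : ℕ) then (1 : ℝ) else 0) + (C : ℝ) * (if (h : ℕ) = (c : ℕ) then (1 : ℝ) else 0)

namespace LawDec

/-- **EVERY ADMISSIBLE FOUR-ATOM LAW WITH A ZERO ATOM IS AD3⁺.**  See the file header. [this work] -/
theorem ad3Decomp_fourAtom (y q T : ℝ) (M a b c : ℕ) (w₀ wa wb wc : ℝ) (ha : 0 < a) (hab : a < b) (hbc : b < c)
    (hcM : c ≤ M) (hy0 : 0 < y) (hyq : y < q) (hq1 : q ≤ 1) (hw₀ : 0 ≤ w₀) (hwa : 0 ≤ wa) (hwb : 0 ≤ wb) (hwc : 0 ≤ wc)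
    (hsum : w₀ + wa + wb + wc = 1) (hmean : (a : ℝ) * wa + (b : ℝ) * wb + (c : ℝ) * wc = T) (hta : y * (M : ℝ) ≤ q * T)
    (hD : ∀ j', j' < M → DECAt y j' M (gate (fun h => QD[a, b, c, w₀, wa, wb, wc, h]) q)) :
    AD3Decomp y q T M (fun h => QD[a, b, c, w₀, wa, wb, wc, h]) := by
  have hq0 : 0 < q := lt_trans hy0 hyq
  have hy1 : y < 1 := lt_of_lt_of_le hyq hq1
  have hbM : b < M := lt_of_lt_of_le hbc hcM
  have haM : a < M := lt_trans hab hbM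
  -- the gated law of a mean-`T` law `v` on the atoms is a four-atom law with masses `(1 − q + qv₀, qv_a, qv_b, qv_c)`
  have hgate : ∀ v₀ va vb vc : ℝ, gate (fun h => QD[a, b, c, v₀, va, vb, vc, h]) q
      = fun h => QD[a, b, c, 1 - q + q * v₀, q * va, q * vb, q * vc, h] := fun v₀ va vb vc => gate_QD a b c v₀ va vb vc q
  have hfacts : ∀ v₀ va vb vc : ℝ, 0 ≤ v₀ → 0 ≤ va → 0 ≤ vb → 0 ≤ vc → v₀ + va + vb + vc = 1 →
      (a : ℝ) * va + (b : ℝ) * vb + (c : ℝ) * vc = T →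
      0 ≤ 1 - q + q * v₀ ∧ 0 ≤ q * va ∧ 0 ≤ q * vb ∧ 0 ≤ q * vc ∧ (1 - q + q * v₀) + q * va + q * vb + q * vc = 1 ∧
        (a : ℝ) * (q * va) + (b : ℝ) * (q * vb) + (c : ℝ) * (q * vc) = q * T := by
    intro v₀ va vb vc h₀ h₁ h₂ h₃ hs hm
    have hqv : 0 ≤ q * v₀ := mul_nonneg hq0.le h₀
    refine ⟨by linarith, by positivity, by positivity, by positivity, by linear_combination q * hs, by rw [← hm]; ring⟩
  obtain ⟨hZ, hA, hB, hC, hsum', hmean'⟩ := hfacts w₀ wa wb wc hw₀ hwa hwb hwc hsum hmean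
  -- `ν`'s own gated law, DEC at every layer
  have hDν : ∀ j', j' < M → DECAt y j' M (fun h => QD[a, b, c, 1 - q + q * w₀, q * wa, q * wb, q * wc, h]) := by
    intro j' hj'; rw [← hgate]; exact hD j' hj'
  by_cases h2a : q * T ≤ 2 * (a : ℝ)
  · -- every mean-`T` law on the atoms is admissible
    refine ad3Decomp_fourAtom_of_levelLine y q T 0 M a b c w₀ wa wb wc ha hab hbc hcM hy0 hyq.le hw₀ hwa hwb hwc hsum hmean ?_
    intro v₀ va vb vc h₀ h₁ h₂ h₃ hs hm _ j' hj'
    obtain ⟨gZ, gA, gB, gC, gs, gm⟩ := hfacts v₀ va vb vc h₀ h₁ h₂ h₃ hs hm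
    rw [hgate]
    exact fourAtom_decAt_of_bigLow y M a b c _ _ _ _ ha hab hbc hcM gZ gA gB gC gs hy0 hy1 (by rw [gm]; exact hta)
      (by rw [gm]; exact h2a) j' hj'
  rw [not_le] at h2a
  have h2aν : 2 * (a : ℝ) < (a : ℝ) * (q * wa) + (b : ℝ) * (q * wb) + (c : ℝ) * (q * wc) := by rw [hmean']; exact h2a
  by_cases hcomp : q * T < (a : ℝ) + b
  · -- the corner regime: admissible ⟺ H1 ∧ C1, i.e. `y ≤ min(1, y(1 + 1/r))·B + C`
    have hcompν : (a : ℝ) * (q * wa) + (b : ℝ) * (q * wb) + (c : ℝ) * (q * wc) < (a : ℝ) + b := by rw [hmean']; exact hcomp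
    have hH1 := fourAtom_H1_of_decAt y M a b c _ _ _ _ ha hab hbc hcM hZ hA hB hC hsum' hy0 hy1 h2aν (hDν a haM)
    have hC1 := fourAtom_C1_of_decAt y M a b c _ _ _ _ ha hab hbc hcM hZ hA hB hC hsum' hy0 hy1 h2aν hcompν (hDν b hbM)
    rw [hmean'] at hC1
    set r : ℝ := usage y (q * T) b a b with hr
    have hr0 : 0 < r := by
      have := usage_pos_of_compat y (q * T) b a b hy0 hy1 h2a hab (Or.inr hcomp)
      simpa only [hr] using this
    set θ : ℝ := min 1 (y * (1 + 1 / r)) with hθ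
    have hθ1 : θ ≤ 1 := min_le_left _ _
    have hθ2 : θ ≤ y * (1 + 1 / r) := min_le_right _ _
    -- `ν` satisfies `y ≤ θB + C`
    have hC1' : y ≤ y * (1 + 1 / r) * (q * wb) + q * wc := by
      have e : y * (1 - q + q * w₀ + q * wa - q * wb / r) = y * (1 - q * wb - q * wc) - y * (q * wb) / r := by
        rw [show 1 - q + q * w₀ + q * wa = 1 - q * wb - q * wc by linarith]; ring
      rw [e] at hC1
      have : y * (1 + 1 / r) * (q * wb) = y * (q * wb) + y * (q * wb) / r := by field_simp
      rw [this]
      linarith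
    have hWν : y ≤ θ * (q * wb) + q * wc := by
      rcases min_choice (1 : ℝ) (y * (1 + 1 / r)) with h | h
      · rw [hθ, h, one_mul]; exact hH1
      · rw [hθ, h]; exact hC1'
    refine ad3Decomp_fourAtom_of_levelLine y q T θ M a b c w₀ wa wb wc ha hab hbc hcM hy0 hyq.le hw₀ hwa hwb hwc hsum hmean ?_
    intro v₀ va vb vc h₀ h₁ h₂ h₃ hs hm hlev j' hj'
    obtain ⟨gZ, gA, gB, gC, gs, gm⟩ := hfacts v₀ va vb vc h₀ h₁ h₂ h₃ hs hm
    rw [hgate]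
    have hWv : y ≤ θ * (q * vb) + q * vc := by
      have : θ * (q * vb) + q * vc = θ * (q * wb) + q * wc := by linear_combination q * hlev
      rw [this]; exact hWν
    have hH1v : y ≤ q * vb + q * vc := by linarith [mul_le_mul_of_nonneg_right hθ1 gB]
    have hC1v : y * (1 - q + q * v₀ + q * va - q * vb / usage y ((a : ℝ) * (q * va) + (b : ℝ) * (q * vb) + (c : ℝ) * (q * vc)) b a b)
        ≤ (1 - y) * (q * vc) := by
      rw [gm, ← hr]
      have h1 : y ≤ y * (1 + 1 / r) * (q * vb) + q * vc := by linarith [mul_le_mul_of_nonneg_right hθ2 gB]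
      have e : y * (1 - q + q * v₀ + q * va - q * vb / r) = y * (1 - q * vb - q * vc) - y * (q * vb) / r := by
        rw [show 1 - q + q * v₀ + q * va = 1 - q * vb - q * vc by linarith]; ring
      rw [e]
      have : y * (1 + 1 / r) * (q * vb) = y * (q * vb) + y * (q * vb) / r := by field_simp
      rw [this] at h1
      linarith
    exact fourAtom_decAt_all_of_corner y M a b c _ _ _ _ ha hab hbc hcM gZ gA gB gC gs hy0 hy1 (by rw [gm]; exact hta)
      (by rw [gm]; exact h2a) (by rw [gm]; exact hcomp) hH1v hC1v j' hj'
  rw [not_lt] at hcomp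
  by_cases h2b : 2 * (b : ℝ) < q * T
  · -- three lows: admissible ⟺ `y ≤ C`
    have h2bν : 2 * (b : ℝ) < (a : ℝ) * (q * wa) + (b : ℝ) * (q * wb) + (c : ℝ) * (q * wc) := by rw [hmean']; exact h2b
    have hH2 := fourAtom_H2_of_decAt y M a b c _ _ _ _ ha hab hbc hcM hZ hA hB hC hsum' hy0 hy1 h2bν (hDν b hbM)
    refine ad3Decomp_fourAtom_of_levelLine y q T 0 M a b c w₀ wa wb wc ha hab hbc hcM hy0 hyq.le hw₀ hwa hwb hwc hsum hmean ?_
    intro v₀ va vb vc h₀ h₁ h₂ h₃ hs hm hlev j' hj'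
    obtain ⟨gZ, gA, gB, gC, gs, gm⟩ := hfacts v₀ va vb vc h₀ h₁ h₂ h₃ hs hm
    rw [hgate]
    have hvc : vc = wc := by simpa using hlev
    exact fourAtom_decAt_all_of_threeLows y M a b c _ _ _ _ ha hab hbc hcM gZ gA gB gC gs hy0 hy1 (by rw [gm]; exact hta)
      (by rw [hvc]; exact hH2) j' hj'
  · -- `b` self-sufficient and incompatible: admissible ⟺ `y ≤ yB + C`
    rw [not_lt] at h2b
    have h2bν : (a : ℝ) * (q * wa) + (b : ℝ) * (q * wb) + (c : ℝ) * (q * wc) ≤ 2 * (b : ℝ) := by rw [hmean']; exact h2b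
    have hcompν : (a : ℝ) + b ≤ (a : ℝ) * (q * wa) + (b : ℝ) * (q * wb) + (c : ℝ) * (q * wc) := by rw [hmean']; exact hcomp
    have hH3 := fourAtom_H3_of_decAt y M a b c _ _ _ _ ha hab hbc hcM hZ hA hB hC hsum' hy0 hy1 h2aν hcompν h2bν (hDν b hbM)
    have hWν : y ≤ y * (q * wb) + q * wc := by
      rw [show 1 - q + q * w₀ + q * wa = 1 - q * wb - q * wc by linarith] at hH3
      linarith
    refine ad3Decomp_fourAtom_of_levelLine y q T y M a b c w₀ wa wb wc ha hab hbc hcM hy0 hyq.le hw₀ hwa hwb hwc hsum hmean ?_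
    intro v₀ va vb vc h₀ h₁ h₂ h₃ hs hm hlev j' hj'
    obtain ⟨gZ, gA, gB, gC, gs, gm⟩ := hfacts v₀ va vb vc h₀ h₁ h₂ h₃ hs hm
    rw [hgate]
    have hWv : y ≤ y * (q * vb) + q * vc := by
      have : y * (q * vb) + q * vc = y * (q * wb) + q * wc := by linear_combination q * hlev
      rw [this]; exact hWν
    have hH3v : y * (1 - q + q * v₀ + q * va) ≤ (1 - y) * (q * vc) := by
      rw [show 1 - q + q * v₀ + q * va = 1 - q * vb - q * vc by linarith]
      linarith
    exact fourAtom_decAt_all_of_incompatible y M a b c _ _ _ _ ha hab hbc hcM gZ gA gB gC gs hy0 hy1 (by rw [gm]; exact hta)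
      (by rw [gm]; exact h2b) hH3v j' hj'

end LawDec

end Quant

end Summit.CriticalPhenomena.PercolationContinuityZ3.Theorems
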